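import Mathlib
import Literature.NumberTheory.LFunctions.WeilExplicit
import Summits.RiemannHypothesis.RiemannHypothesis.Theorems.SignConeConeMagnificationDesignDeficit
import Summits.RiemannHypothesis.RiemannHypothesis.Theorems.SignConeConeMagnificationDesignAxB

/-!
# Crux `SignCone.ConeMagnification` (stmt-RiemannHypothesis-16303), line `Sketch` r8:
# AX-C and the registered stub `stub_designOfTypes` (the open core) — PROVED

Seat-0 programme, final file.  The Riesz–Euler design inequality AX-C of the landed finite spine
(`stub_deficitOfDesign`) is LITERALLY a normalised type inequality: the killer design `⊛_{p∈S} K(t_p, e^{iφ})` with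
`p t_p/(t_p² + p) = √p a_p/2` has gcd form `K · 𝟙[S-squarefree] · √(n_A) · Π_A a_p · 2^{-|A|} · e^{i|A|φ}`
(`gcdForm_killerDesign` with `Q = D = S`), so TI gives the limit of the partial sums `≤ ½`, and AX-A (landed in
`SignConeConeMagnificationDesignDeficit`) makes the series absolutely convergent, so its `tsum` is that limit
(`designIneq_of_TI`).  Together with AX-A (`summable_abs_dwt_div`) and AX-B (`summable_compMassTerm`) this proves the
registered stub `stub_designOfTypes` of the skeleton `Cruxes/ConeMagnification/Lines/Sketch.lean` (r8) VERBATIM —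
using, of its hypotheses, only `c ≥ 0`, Loc and the type inequalities (¬RH, unit slack, `hsum`, the Carathéodory
data and Chebyshev/Mertens are not needed).  With the lead's `stub_fakeMertens`, `stub_combZeroSideC`,
`stub_combLocal`, `stub_combType` the composition `ConeMagnification_of` then closes the crux.
-/

noncomputable section

-- `Summit.RiemannHypothesis.RiemannHypothesis.…` repeats a namespace component by design (D-0017 layout).
set_option linter.dupNamespace false

open Finset Filter
open scoped BigOperators ComplexConjugate Topology

namespace Summit.RiemannHypothesis.RiemannHypothesis.Theorems.SignConeConeMagnification

open Literature.NumberTheory.LFunctions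

namespace Design

/-- The product of the killer moduli `√p a_p/2` over `A` is the Riesz–Euler design weight. [folklore] -/
theorem prod_sqrt_mul_half (a : ℕ → ℝ) (A : Finset ℕ) :
    ∏ p ∈ A, Real.sqrt p * a p / 2 =
      Real.sqrt (∏ p ∈ A, (p : ℝ)) * (∏ p ∈ A, a p) * (1 / 2) ^ A.card := by
  rw [Real.sqrt_prod _ fun p _ => Nat.cast_nonneg p, ← Finset.prod_mul_distrib, ← Finset.prod_const,
    ← Finset.prod_mul_distrib]
  exact Finset.prod_congr rfl fun p _ => by ring

/-- **AX-C from TI and AX-A** (seat-0, design algebra §4): for a finite set `S` of primes, `a_p ∈ [0,1]` and `φ`,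
`Σ'_n ((c(n) − Λ(n))/n) Φ_{S,a,φ}(n) ≤ 1/2`. [folklore] -/
theorem designIneq_of_TI (c : ℕ → ℝ)
    (hTI : ∀ α : ℕ → ℂ, ∀ L : ℕ, (∀ m, L < m → α m = 0) →
      ∃ T : ℝ, Tendsto (fun x : ℝ => ∑ n ∈ Finset.Icc 1 ⌊x⌋₊,
          (c n - ArithmeticFunction.vonMangoldt n) / n *
            (∑ ℓ ∈ Finset.Icc 1 L, ∑ ℓ' ∈ Finset.Icc 1 L, α ℓ * (starRingEnd ℂ) (α ℓ') *
            (((Nat.gcd (n * ℓ') ℓ : ℕ) : ℝ) : ℂ) / (Real.sqrt ((ℓ : ℝ) * ℓ') : ℂ)).re) atTop (𝓝 T) ∧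
        T ≤ 1 / 2 * (∑ ℓ ∈ Finset.Icc 1 L, ∑ ℓ' ∈ Finset.Icc 1 L, α ℓ * (starRingEnd ℂ) (α ℓ') *
            (((Nat.gcd (1 * ℓ') ℓ : ℕ) : ℝ) : ℂ) / (Real.sqrt ((ℓ : ℝ) * ℓ') : ℂ)).re)
    (hA : Summable (fun n : ℕ => |c n - ArithmeticFunction.vonMangoldt n| / n))
    (S : Finset ℕ) (hS : ∀ p ∈ S, p.Prime) (a : ℕ → ℝ) (ha : ∀ p ∈ S, 0 ≤ a p ∧ a p ≤ 1) (φ : ℝ) :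
    (∑' n : ℕ, (c n - ArithmeticFunction.vonMangoldt n) / (n : ℝ) *
      (if ∀ p ∈ S, ¬ (p ^ 2 ∣ n) then
        Real.sqrt (∏ p ∈ S.filter (· ∣ n), (p : ℝ)) * (∏ p ∈ S.filter (· ∣ n), a p) *
          (1 / 2) ^ (S.filter (· ∣ n)).card * Real.cos (((S.filter (· ∣ n)).card : ℝ) * φ)
      else 0)) ≤ 1 / 2 := by
  classical
  -- the killer design at moduli `√p a_p / 2`, rotated by `e^{iφ}`
  have hm : ∀ p ∈ S, 0 ≤ Real.sqrt p * a p / 2 ∧ Real.sqrt p * a p / 2 ≤ Real.sqrt p / 2 := by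
    intro p hp
    have hs := Real.sqrt_nonneg (p : ℝ)
    constructor
    · have := (ha p hp).1; positivity
    · have := mul_le_mul_of_nonneg_left (ha p hp).2 hs
      linarith
  obtain ⟨α, L, K, hK, hsupp, hprof⟩ := gcdForm_killerDesign S S hS (subset_refl S)
    (fun p => Real.sqrt p * a p / 2) hm (Complex.exp (φ * Complex.I)) (Complex.exp_ne_zero _) (conj_expUnit φ)
  set W : ℕ → ℝ := fun n => if ∀ p ∈ S, ¬ (p ^ 2 ∣ n) then
      Real.sqrt (∏ p ∈ S.filter (· ∣ n), (p : ℝ)) * (∏ p ∈ S.filter (· ∣ n), a p) *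
        (1 / 2) ^ (S.filter (· ∣ n)).card * Real.cos (((S.filter (· ∣ n)).card : ℝ) * φ) else 0 with hWdef
  set Z : ℕ → ℂ := fun n => (if (∀ q ∈ S \ S, ¬ q ∣ n) ∧ (∀ p ∈ S, ¬ p ^ 2 ∣ n) then
      (∏ p ∈ S.filter (· ∣ n), (((Real.sqrt p * a p / 2 : ℝ)) : ℂ)) *
        (Complex.exp (φ * Complex.I)) ^ (S.filter (· ∣ n)).card else 0) with hZdef
  obtain ⟨T, hT, hTle⟩ := tendsto_TI_profile c hTI α L K hK hsupp Z (fun n hn => hprof n hn)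
  have hZre : ∀ n, (Z n).re = W n := by
    intro n
    have hvac : (∀ q ∈ S \ S, ¬ q ∣ n) := fun q hq => by simp at hq
    simp only [hZdef, hWdef]
    by_cases h : ∀ p ∈ S, ¬ p ^ 2 ∣ n
    · rw [if_pos ⟨hvac, h⟩, if_pos h, ← Complex.ofReal_prod, Complex.re_ofReal_mul, re_exp_pow,
        prod_sqrt_mul_half]
    · rw [if_neg (fun h' => h h'.2), if_neg h, Complex.zero_re]
  simp_rw [hZre] at hT hTle
  have hW1 : W 1 = 1 := by
    have h1 : ∀ p ∈ S, ¬ p ^ 2 ∣ 1 := fun p hp h => by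
      have h3 : 1 < p ^ 2 := Nat.one_lt_pow two_ne_zero (hS p hp).one_lt
      have := Nat.dvd_one.1 h
      omega
    simp only [hWdef, if_pos h1, filter_dvd_eq_empty (not_exists_prime_dvd_one hS), Finset.card_empty,
      Finset.prod_empty, Real.sqrt_one]
    simp
  rw [hW1, mul_one] at hTle
  -- the series converges absolutely (AX-A)
  have hWB : ∀ n, |W n| ≤ Real.sqrt (∏ p ∈ S, (p : ℝ)) := by
    intro n
    simp only [hWdef]
    split_ifs with h
    · have hsub : S.filter (· ∣ n) ⊆ S := Finset.filter_subset _ _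
      have h1 : Real.sqrt (∏ p ∈ S.filter (· ∣ n), (p : ℝ)) ≤ Real.sqrt (∏ p ∈ S, (p : ℝ)) :=
        Real.sqrt_le_sqrt (Finset.prod_le_prod_of_subset_of_one_le hsub (fun p _ => Nat.cast_nonneg p)
          (fun p hp _ => by exact_mod_cast (hS p hp).one_lt.le))
      have h2 : |∏ p ∈ S.filter (· ∣ n), a p| ≤ 1 := by
        rw [Finset.abs_prod]
        exact Finset.prod_le_one (fun p _ => abs_nonneg _)
          (fun p hp => abs_le.2 ⟨by linarith [(ha p (hsub hp)).1], (ha p (hsub hp)).2⟩)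
      have h3 : |((1 : ℝ) / 2) ^ (S.filter (· ∣ n)).card| ≤ 1 := by
        rw [abs_of_nonneg (by positivity)]
        exact pow_le_one₀ (by norm_num) (by norm_num)
      have h4 := Real.abs_cos_le_one (((S.filter (· ∣ n)).card : ℝ) * φ)
      rw [abs_mul, abs_mul, abs_mul, abs_of_nonneg (Real.sqrt_nonneg _)]
      have h0 : 0 ≤ Real.sqrt (∏ p ∈ S.filter (· ∣ n), (p : ℝ)) := Real.sqrt_nonneg _
      calc Real.sqrt (∏ p ∈ S.filter (· ∣ n), (p : ℝ)) * |∏ p ∈ S.filter (· ∣ n), a p| *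
            |((1 : ℝ) / 2) ^ (S.filter (· ∣ n)).card| * |Real.cos (((S.filter (· ∣ n)).card : ℝ) * φ)|
          ≤ Real.sqrt (∏ p ∈ S.filter (· ∣ n), (p : ℝ)) * 1 * 1 * 1 := by
            gcongr
      _ ≤ Real.sqrt (∏ p ∈ S, (p : ℝ)) := by linarith
    · rw [abs_zero]; exact Real.sqrt_nonneg _
  have hgs : Summable (fun n : ℕ => (c n - ArithmeticFunction.vonMangoldt n) / (n : ℝ) * W n) := by
    refine Summable.of_norm_bounded (hA.mul_left (Real.sqrt (∏ p ∈ S, (p : ℝ)))) fun n => ?_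
    rw [Real.norm_eq_abs, abs_mul, abs_div, Nat.abs_cast, mul_comm]
    exact mul_le_mul_of_nonneg_right (hWB n) (by positivity)
  have hlim := tendsto_sum_Icc_floor_of_summable _ (by simp) hgs
  rw [tendsto_nhds_unique hlim hT]
  exact hTle

end Design

open Design

/-- **Registered stub `stub_designOfTypes` of the skeleton `Cruxes/ConeMagnification/Lines/Sketch.lean` (r8; the open
core of the crux since r6) — PROVED** (seat-0, second-order design algebra): for `c ≥ 0` with local summability
`Σ_{p∣n} c(n)/n < ∞` and the type inequalities for every finitely supported complex design, the 2001 design data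
AX-A (`Σ |c−Λ|(n)/n < ∞`), AX-B (composite mass) and AX-C (Riesz–Euler design inequality with constant `1/2`) hold.
The other hypotheses of the stub (`¬RH`, `c 1 = 0`, unit slack, `hsum`, the Carathéodory data, Chebyshev/Mertens)
are not used.  Proof: `SignConeConeMagnificationDesign{GcdForm,Blocks,Profiles,Classes,StepOne,Fejer,ClassFacts,
DeficitStep,Deficit,AxB}.lean`. [folklore] -/
theorem stub_designOfTypes :
    ¬ RiemannHypothesis →
    ∀ c : ℕ → ℝ, (∀ n, 0 ≤ c n) → c 1 = 0 →
      (∀ g : ℝ → ℂ, IsWeilTest g →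
        -(∫ t, ‖g t‖ ^ 2) ≤
          (weilPolarTerm (weilConv g (weilReflect g)) + weilArchTerm (weilConv g (weilReflect g)) -
            ∑' n : ℕ, ((c n : ℝ) : ℂ) / (Real.sqrt n : ℂ) *
              (weilConv g (weilReflect g) (Real.log n) + weilConv g (weilReflect g) (-Real.log n))).re) →
      (∀ σ : ℝ, 1 < σ → LSeriesSummable (fun n => ((c n : ℝ) : ℂ)) σ) →
      (∃ F : ℂ → ℂ, DifferentiableOn ℂ F {s : ℂ | 1 / 2 < s.re} ∧
        (∀ s : ℂ, 1 < s.re → F s = LSeries (fun n => ((c n : ℝ) : ℂ)) s - 1 / (s - 1)) ∧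
        ∀ s : ℂ, 1 / 2 < s.re →
          (F s).re ≤ 1 / 2 + (1 / s).re +
            1 / (2 * Real.pi) * (∫ v : ℝ, (Complex.digamma (1 / 4 + v / 2 * Complex.I)).re *
              ((s.re - 1 / 2) / ((s.re - 1 / 2) ^ 2 + (s.im - v) ^ 2))) - Real.log Real.pi / 2) →
      ((∃ A : ℝ, ∀ x : ℝ, 1 ≤ x → ∑ n ∈ Finset.Icc 1 ⌊x⌋₊, c n ≤ A * x) ∧
        (∃ C : ℝ, Filter.Tendsto (fun x : ℝ => (∑ n ∈ Finset.Icc 1 ⌊x⌋₊, c n / n) - Real.log x)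
          Filter.atTop (nhds C))) →
      (∀ p : ℕ, p.Prime → Summable (fun n : ℕ => if p ∣ n then c n / n else 0)) →
      (∀ α : ℕ → ℂ, ∀ L : ℕ, (∀ m, L < m → α m = 0) →
        ∃ T : ℝ, Filter.Tendsto (fun x : ℝ => ∑ n ∈ Finset.Icc 1 ⌊x⌋₊,
            (c n - ArithmeticFunction.vonMangoldt n) / n *
              (∑ ℓ ∈ Finset.Icc 1 L, ∑ ℓ' ∈ Finset.Icc 1 L, α ℓ * (starRingEnd ℂ) (α ℓ') *
              (((Nat.gcd (n * ℓ') ℓ : ℕ) : ℝ) : ℂ) / (Real.sqrt ((ℓ : ℝ) * ℓ') : ℂ)).re) Filter.atTop (nhds T) ∧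
          T ≤ 1 / 2 * (∑ ℓ ∈ Finset.Icc 1 L, ∑ ℓ' ∈ Finset.Icc 1 L, α ℓ * (starRingEnd ℂ) (α ℓ') *
              (((Nat.gcd (1 * ℓ') ℓ : ℕ) : ℝ) : ℂ) / (Real.sqrt ((ℓ : ℝ) * ℓ') : ℂ)).re) →
      Summable (fun n : ℕ => |c n - ArithmeticFunction.vonMangoldt n| / (n : ℝ)) ∧
      Summable (fun n : ℕ => if 2 ≤ n ∧ ¬ IsPrimePow n then
        c n / (n : ℝ) * (∑ q ∈ n.primeFactors, ∑ q' ∈ n.primeFactors.filter (fun q' => q < q'),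
          ((Real.sqrt q - 1) / 2) * ((Real.sqrt q' - 1) / 2)) else 0) ∧
      (∀ S : Finset ℕ, (∀ p ∈ S, p.Prime) → ∀ a : ℕ → ℝ, (∀ p ∈ S, 0 ≤ a p ∧ a p ≤ 1) → ∀ φ : ℝ,
        (∑' n : ℕ, (c n - ArithmeticFunction.vonMangoldt n) / (n : ℝ) *
          (if ∀ p ∈ S, ¬ (p ^ 2 ∣ n) then
            Real.sqrt (∏ p ∈ S.filter (· ∣ n), (p : ℝ)) * (∏ p ∈ S.filter (· ∣ n), a p) *
              (1 / 2) ^ (S.filter (· ∣ n)).card * Real.cos (((S.filter (· ∣ n)).card : ℝ) * φ)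
          else 0)) ≤ 1 / 2) := by
  intro _ c hc0 _ _ _ _ _ hLoc hTI
  have hAXA := summable_abs_dwt_div c hc0 hLoc hTI
  exact ⟨hAXA, summable_compMassTerm c hc0 hLoc hTI, fun S hS a ha φ => designIneq_of_TI c hTI hAXA S hS a ha φ⟩

end Summit.RiemannHypothesis.RiemannHypothesis.Theorems.SignConeConeMagnification
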